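import Summits.QuantumFields.YangMills.Theorems.BalabanUVNodesN11KernelTransportRecoordinatisation
import Literature.MathematicalPhysics.QuantumFieldTheory.Balaban1983to89.HaarDensitySpecialUnitaryGlobalPi
import Literature.MathematicalPhysics.QuantumFieldTheory.Balaban1983to89.Node00.TStepOfRecord

/-!
# DAG node N11 — FIBRE-CHART SOCKETS ARE NATURAL UNDER (WEIGHTED) PRESENTATIONS OF BOTH CARRIERS; ME #37 step S1 («σ(A′)dA′») AT THE RECORD

HEADER — WORK-UNIT METADATA.  Cell `pub-ymgap`, YM-PLAN Track A (HUMAN RULING D-0062 ∕ D-0149), WIDTH SEAT `pub-ymgap-dag-n11-w2` (g3) on node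
N11 [B14]; route `BalabanUVNodes`, key item K1⁷ `StabilityBAtRecordR13SepCoPH` = stmt-QuantumFields-20542 (helper, `--kind proof --supports 20542
--as helper`, count-neutral).  [I] = [Balaban1987RG1], [III] = [Balaban1988Convergent], [16] = [Balaban1985UV3].  Bus: CLAIM-4 = INTENT-4 of this seat
(R455 (A)).  Sequel of FILE 2 `…N11KernelTransportRecoordinatisation` §3 (sockets compose with a density-free presentation of the fine carrier).

WHY.  dag-n11-d's (B4) SOCKET (p610288: `hpush : ((μ ⊗ₘ κ).withDensity J).map Ψ = ν.restrict S`, `hfib`) is stated at the record's GROUP-valued carriers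
(`ν = fieldMeasure k`, base `μ = fieldMeasure (k+1)`), while every chart anybody can compute — dag-n11-w6's linear∕linearised δ-removal charts (ME #37 steps
S2∘S3, [I] p.267, [16] (17)–(18)), dag-n09-w2's Euclidean fibre-coordinate engine, dag-n07-w2's chart `D` of [15] (47) — lives in CANONICAL COORDINATES:
Lie-algebra-valued bond fields with Lebesgue-type references.  The passage is ME #37 step S1 «dU′ = σ(A′)dA′» ([16] p.260; lit-balaban p28
`HaarDensitySpecialUnitaryGlobalPi`: the bondwise exponential chart is MEASURE-PRESERVING from `⊗_b coordMeasure` onto product Haar), applied to the socket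
on BOTH sides: the fine carrier (FILE 2 §3, density-free; §2 here with a density) and the BASE of `μ ⊗ₘ κ` (§1 here: a measurable, possibly weighted,
presenting map of the coarse carrier — NOT an equivalence, the exponential chart being only a.e.-bijective — with the fibre kernel pulled back by
`Kernel.comap`).  §3 states S1 at the record by name.

WHAT THIS FILE PROVES (generic measurable spaces, s-finite measures ∕ kernels; 0 `def`, 0 `sorry`).
* §1 COARSE PRESENTATION — ★ `compProd_map_left_eq_map_compProd_comap` (`(μ'.map e) ⊗ₘ κ = (μ' ⊗ₘ κ.comap e) .map (Prod.map e id)`);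
  ★★ `socket_of_coarse_presentation` (from `M'.map e = μb` and the COORDINATE-SIDE identity
  `(((M' ⊗ₘ κ.comap e).withDensity (J ∘ (e × id))).map (Ψ ∘ (e × id)) = ν.restrict S` conclude `((μb ⊗ₘ κ).withDensity J).map Ψ = ν.restrict S`; `M'` may be
  `(μ'.restrict T').withDensity jα` — a weighted, windowed presentation); `ae_fib_of_coarse_presentation` (the socket's `hfib` transported the same way).
* §2 FINE WEIGHTED PRESENTATION — ★★ `socket_of_fine_weighted_presentation` (`M.map Ψ' = ν'.restrict S'` and `((ν'.restrict S').withDensity j).map e = ν.restrict S`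
  ⇒ `(M.withDensity (j ∘ Ψ')).map (e ∘ Ψ') = ν.restrict S`; for `M = (μ ⊗ₘ κ).withDensity J` the Jacobian becomes `J · (j ∘ Ψ')`:
  `socket_of_fine_weighted_presentation_compProd`); `ae_mem_of_map_eq_restrict`, `ae_fib_of_fine_presentation` (`hfib` transported under an intertwining ON `S'`).
* §3 AT THE RECORD (`G = SU(N)`; `𝔤 = (specialUnitaryLogChart (Fin N)).lie` with a Borel structure and an additive Haar measure `η`; Θ = bondwise `expChart`):
  `fieldMeasure_eq_map_pi_expChart` (p28's S1 as a presentation: `(⊗_b coordMeasure η haar).map Θ = fieldMeasure P j (SU N)`);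
  ★★ `socket_fieldMeasure_of_socket_coordMeasure_fine` (a socket whose chart lands in 𝔤-valued level-`j` bond fields with reference `⊗ coordMeasure` IS a socket at
  `fieldMeasure P j (SU N)` for the composed chart); ★★ `socket_fieldMeasure_of_socket_coordMeasure_coarse` (a socket with BASE `⊗ coordMeasure` on 𝔤-valued
  level-`j'` fields IS a socket with base `fieldMeasure P j' (SU N)`).

NOT IN THIS FILE: any chart of Bałaban's or its Jacobian (dag-n11-w6 S2∘S3, dag-n07-w2 (47)∕(73)), `σ`∕`σ₀` evaluated (p28), the identification of
`⊗ coordMeasure` with a Lebesgue measure with density on a product alcove (a `Measure.pi`∕`withDensity` bookkeeping the chart seat may want; p28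
`coordMeasure_eq_withDensity_prod_sinc` per bond), the `regSet` layer (dag-n09-w6), the socket itself (dag-n11-d).

HONEST FRAMING.  Helper lane of K1⁷, count-neutral; [folklore] measure theory (`Measure.lintegral_compProd`, `lintegral_map`, `withDensity`∕`map`∕`restrict` algebra,
`ae_map_iff`) + lit-balaban p28 BY NAME; nothing of Bałaban's asserted; (B4) ∕ (S-α) NOT closed; no registered stub proved; N11 NOT discharged; K1⁷ NOT closed;
counts unmoved (typed 28∕28 · discharged 5∕27).  One finite four-torus programme at fixed `ε = L^{−K}`; R4 closes only the conditional finite-𝕋⁴ rung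
`BalabanLadder.UV` — NOT ℝ⁴, NOT OS, NOT a mass gap, NOT Clay.  No `sorry`, `axiom`, `def`, `instance`, `notation`.  Sources (SHAPE only): [16] (13), (18)
p.260; [I] (0.4) p.253, §2 p.267; [III] (3.1) p.264.
-/

noncomputable section

open MeasureTheory ProbabilityTheory Set Filter
open scoped ENNReal NNReal Matrix.Norms.L2Operator

namespace Summit.QuantumFields.YangMills.Theorems.BalabanUVNodesN11FibreChartSocketRecoordinatisation

open Literature.MathematicalPhysics.QuantumFieldTheory.Balaban1983to89
open BalabanUVNodesN11KernelTransportRecoordinatisation (map_comp_eq_restrict_of_map_eq_restrict_preimage)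

/-! ## §1  Presenting the BASE of `μ ⊗ₘ κ` (the coarse carrier) by a measurable, possibly weighted map -/

section Coarse

variable {α α' β X : Type*} [MeasurableSpace α] [MeasurableSpace α'] [MeasurableSpace β] [MeasurableSpace X]

/-- ★ **The composition-product over a presented base**: `(μ'.map e) ⊗ₘ κ = (μ' ⊗ₘ κ.comap e).map (Prod.map e id)` — the fibre kernel is read at
the presented point, the base point presented afterwards (both sides have the same `lintegral`s: `Measure.lintegral_compProd`, `lintegral_map`). -/
theorem compProd_map_left_eq_map_compProd_comap (μ' : Measure α') [SFinite μ'] (κ : Kernel α X) [IsSFiniteKernel κ]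
    {e : α' → α} (he : Measurable e) :
    (μ'.map e) ⊗ₘ κ = (μ' ⊗ₘ (κ.comap e he)).map (Prod.map e id) := by
  refine Measure.ext_of_lintegral _ fun f hf => ?_
  have hpm : Measurable (Prod.map e (id : X → X)) := he.prodMap measurable_id
  rw [Measure.lintegral_compProd hf, lintegral_map hf.lintegral_kernel_prod_right' he, lintegral_map hf hpm,
    Measure.lintegral_compProd (f := fun z => f (Prod.map e id z)) (hf.comp hpm)]
  simp only [Kernel.comap_apply, Prod.map_apply, id_eq]

/-- `withDensity` after a push-forward is the push-forward of `withDensity` of the pulled-back density (equal `lintegral`s). -/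
theorem withDensity_map_eq_map_withDensity_comp {Z W : Type*} [MeasurableSpace Z] [MeasurableSpace W] (P : Measure Z)
    {h : Z → W} (hh : Measurable h) {J : W → ℝ≥0∞} (hJ : Measurable J) :
    (P.map h).withDensity J = (P.withDensity (J ∘ h)).map h := by
  refine Measure.ext_of_lintegral _ fun g hg => ?_
  rw [lintegral_withDensity_eq_lintegral_mul _ hJ hg, lintegral_map (hJ.mul hg) hh, lintegral_map hg hh]
  exact (lintegral_withDensity_eq_lintegral_mul _ (hJ.comp hh) (hg.comp hh)).symm

/-- ★★ **A SOCKET IS NATURAL IN THE BASE.**  Let the base `μb` of dag-n11-d's socket be PRESENTED by a measurable map `e : α' → α` from an s-finite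
measure `M'` on coordinates (`M'.map e = μb`; e.g. `M' = (μ'.restrict T').withDensity jα` — a windowed, weighted presentation such as the bondwise exponential
chart from `⊗ coordMeasure`, or Lebesgue with the Haar density on a product alcove).  If the socket identity holds ON THE COORDINATE SIDE — fibre kernel read
at the presented point (`κ.comap e`), Jacobian and chart composed with `e × id` —
`(((M' ⊗ₘ κ.comap e).withDensity (z ↦ J (e z.1, z.2))).map (z ↦ Ψ (e z.1, z.2)) = ν.restrict S`, then it holds at the presented base:
`((μb ⊗ₘ κ).withDensity J).map Ψ = ν.restrict S`. -/
theorem socket_of_coarse_presentation (M' : Measure α') [SFinite M'] {e : α' → α} (he : Measurable e) {μb : Measure α} (hμ : M'.map e = μb)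
    (κ : Kernel α X) [IsSFiniteKernel κ] {J : α × X → ℝ≥0∞} (hJ : Measurable J) {Ψ : α × X → β} (hΨ : Measurable Ψ)
    {ν : Measure β} {S : Set β}
    (hpush' : ((M' ⊗ₘ (κ.comap e he)).withDensity (fun z => J (e z.1, z.2))).map (fun z => Ψ (e z.1, z.2)) = ν.restrict S) :
    ((μb ⊗ₘ κ).withDensity J).map Ψ = ν.restrict S := by
  have hpm : Measurable (Prod.map e (id : X → X)) := he.prodMap measurable_id
  rw [← hμ, compProd_map_left_eq_map_compProd_comap M' κ he, withDensity_map_eq_map_withDensity_comp _ hpm hJ,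
    Measure.map_map hΨ hpm]
  exact hpush'

/-- The socket's fibre identity transported the same way: if `avg (Ψ (e y, x)) = e y` for `((M' ⊗ₘ κ.comap e)·J∘(e×id))`-a.e. `(y, x)`, then
`avg (Ψ z) = z.1` for `((μb ⊗ₘ κ)·J)`-a.e. `z` (the carrier of the identity is measurable when the coarse carrier has a measurable diagonal). -/
theorem ae_fib_of_coarse_presentation [MeasurableEq α] (M' : Measure α') [SFinite M'] {e : α' → α} (he : Measurable e)
    {μb : Measure α} (hμ : M'.map e = μb) (κ : Kernel α X) [IsSFiniteKernel κ] {J : α × X → ℝ≥0∞} (hJ : Measurable J)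
    {Ψ : α × X → β} (hΨ : Measurable Ψ) {avg : β → α} (havg : Measurable avg)
    (hfib' : ∀ᵐ z ∂((M' ⊗ₘ (κ.comap e he)).withDensity (fun z => J (e z.1, z.2))), avg (Ψ (e z.1, z.2)) = e z.1) :
    ∀ᵐ z ∂((μb ⊗ₘ κ).withDensity J), avg (Ψ z) = z.1 := by
  have hpm : Measurable (Prod.map e (id : X → X)) := he.prodMap measurable_id
  rw [← hμ, compProd_map_left_eq_map_compProd_comap M' κ he, withDensity_map_eq_map_withDensity_comp _ hpm hJ]
  exact (ae_map_iff hpm.aemeasurable (measurableSet_eq_fun (havg.comp hΨ) measurable_fst)).2 hfib'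

end Coarse

/-! ## §2  Presenting the FINE carrier by a weighted map (socket level) -/

section Fine

variable {Z α β β' : Type*} [MeasurableSpace Z] [MeasurableSpace α] [MeasurableSpace β] [MeasurableSpace β']

/-- ★★ **A SOCKET IS NATURAL IN THE FINE CARRIER, WITH A DENSITY.**  If a chart `Ψ'` into coordinates pushes a reference `M` onto `ν'` restricted to a
charted set `S'` (`M.map Ψ' = ν'.restrict S'`) and `e : β' → β` presents `ν` on `S` by `ν'` on `S'` WITH DENSITY `j` (`((ν'.restrict S').withDensity j).map e =
ν.restrict S` — e.g. a `C¹` change of variables with `j = |det e′|`, Mathlib `map_withDensity_abs_det_fderiv_eq_addHaar`; or the exponential chart with the Haar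
density, [16] (13)), then the composed chart with the composed Jacobian is a socket onto `ν`: `(M.withDensity (j ∘ Ψ')).map (e ∘ Ψ') = ν.restrict S`. -/
theorem socket_of_fine_weighted_presentation (M : Measure Z) {Ψ' : Z → β'} (hΨ' : Measurable Ψ') {j : β' → ℝ≥0∞} (hj : Measurable j)
    {e : β' → β} (he : Measurable e) {ν' : Measure β'} {ν : Measure β} {S' : Set β'} {S : Set β}
    (hpush'' : M.map Ψ' = ν'.restrict S') (hpres : ((ν'.restrict S').withDensity j).map e = ν.restrict S) :
    (M.withDensity (j ∘ Ψ')).map (e ∘ Ψ') = ν.restrict S := by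
  rw [← Measure.map_map he hΨ', ← withDensity_map_eq_map_withDensity_comp M hΨ' hj, hpush'']
  exact hpres

/-- … for dag-n11-d's reference `M = (μ ⊗ₘ κ).withDensity J` the two Jacobians multiply:
`((μ ⊗ₘ κ).withDensity (z ↦ J z * j (Ψ' z))).map (e ∘ Ψ') = ν.restrict S`. -/
theorem socket_of_fine_weighted_presentation_compProd {X : Type*} [MeasurableSpace X] (μ : Measure α) (κ : Kernel α X)
    {Ψ' : α × X → β'} (hΨ' : Measurable Ψ') {j : β' → ℝ≥0∞} (hj : Measurable j) {J : α × X → ℝ≥0∞} (hJ : Measurable J)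
    {e : β' → β} (he : Measurable e) {ν' : Measure β'} {ν : Measure β} {S' : Set β'} {S : Set β}
    (hpush'' : ((μ ⊗ₘ κ).withDensity J).map Ψ' = ν'.restrict S') (hpres : ((ν'.restrict S').withDensity j).map e = ν.restrict S) :
    ((μ ⊗ₘ κ).withDensity (fun z => J z * j (Ψ' z))).map (e ∘ Ψ') = ν.restrict S := by
  have hmul : (μ ⊗ₘ κ).withDensity (fun z => J z * j (Ψ' z)) = ((μ ⊗ₘ κ).withDensity J).withDensity (j ∘ Ψ') := by
    rw [← withDensity_mul _ hJ (hj.comp hΨ')]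
    rfl
  rw [hmul]
  exact socket_of_fine_weighted_presentation _ hΨ' hj he hpush'' hpres

/-- Under a socket `M.map Ψ' = ν'.restrict S'` the chart lands in the charted set almost surely. -/
theorem ae_mem_of_map_eq_restrict (M : Measure Z) {Ψ' : Z → β'} (hΨ' : Measurable Ψ') {ν' : Measure β'} {S' : Set β'}
    (hS' : MeasurableSet S') (hpush'' : M.map Ψ' = ν'.restrict S') : ∀ᵐ z ∂M, Ψ' z ∈ S' := by
  have h0 : (M.map Ψ') S'ᶜ = 0 := by rw [hpush'', Measure.restrict_apply hS'.compl]; simp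
  rw [Measure.map_apply hΨ' hS'.compl] at h0
  rw [ae_iff]
  exact h0

omit [MeasurableSpace α] [MeasurableSpace β] in
/-- The socket's fibre identity transported along a weighted fine presentation intertwining the averagings ON the charted set
(`avg (e y) = avg' y` for `y ∈ S'`): from `avg' (Ψ' z) = c z` a.e. to `avg (e (Ψ' z)) = c z` a.e. for the re-weighted reference. -/
theorem ae_fib_of_fine_presentation (M : Measure Z) {Ψ' : Z → β'} (hΨ' : Measurable Ψ') (j : β' → ℝ≥0∞)
    {e : β' → β} {ν' : Measure β'} {S' : Set β'} (hS' : MeasurableSet S') (hpush'' : M.map Ψ' = ν'.restrict S')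
    {avg : β → α} {avg' : β' → α} (hint : ∀ y, y ∈ S' → avg (e y) = avg' y) {c : Z → α}
    (hfib'' : ∀ᵐ z ∂M, avg' (Ψ' z) = c z) :
    ∀ᵐ z ∂(M.withDensity (j ∘ Ψ')), avg (e (Ψ' z)) = c z := by
  refine (withDensity_absolutelyContinuous M (j ∘ Ψ')).ae_le ?_
  filter_upwards [hfib'', ae_mem_of_map_eq_restrict M hΨ' hS' hpush''] with z hz hzS
  rw [hint _ hzS, hz]

end Fine

/-! ## §3  AT THE RECORD — ME #37 step S1: sockets in canonical coordinates are sockets at `fieldMeasure` -/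

section Record

open HaarDensitySpecialUnitaryGlobal HaarExponentialChart T4Continuum

variable {N : ℕ} [NeZero N]
variable [MeasurableSpace (specialUnitaryLogChart (Fin N)).lie] [BorelSpace (specialUnitaryLogChart (Fin N)).lie]
  (η : Measure (specialUnitaryLogChart (Fin N)).lie) [η.IsAddHaarMeasure]

/-- The bondwise exponential chart `A ↦ (b ↦ e^{A b})` into `SU(N)`-valued bond fields is measurable (p28's `measurable_expChart` per bond). -/
theorem measurable_pi_expChart (P : Params) (j : ℕ) :
    Measurable (fun A : PBond P j → (specialUnitaryLogChart (Fin N)).lie =>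
      fun b => (isChartRep_specialUnitaryGroup (n := Fin N)).expChart (A b)) :=
  measurable_pi_lambda _ fun b =>
    (isChartRep_specialUnitaryGroup (n := Fin N)).measurable_expChart.comp (measurable_pi_apply b)

/-- **S1 AS A PRESENTATION**: the bondwise exponential chart carries lit-balaban p28's product coordinate measure `⊗_b coordMeasure η dU` (Lebesgue on the
alcove with the Haar density `σ₀·|det jac|`, per bond) onto the cell's product Haar measure `fieldMeasure P j (SU N)` — «dU′ = σ(A′)dA′» for every bond at once
(`measurePreserving_pi_expChart_specialUnitaryGroup` at the cell's `HaarData.haar = haarProbability`). [16] (13), (18) p.260. -/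
theorem fieldMeasure_eq_map_pi_expChart (P : Params) (j : ℕ) :
    (Measure.pi fun _ : PBond P j =>
        coordMeasure η (HaarData.haar : Measure (Matrix.specialUnitaryGroup (Fin N) ℂ))).map
      (fun A : PBond P j → (specialUnitaryLogChart (Fin N)).lie =>
        fun b => (isChartRep_specialUnitaryGroup (n := Fin N)).expChart (A b))
      = fieldMeasure P j (Matrix.specialUnitaryGroup (Fin N) ℂ) := by
  haveI : (HaarData.haar : Measure (Matrix.specialUnitaryGroup (Fin N) ℂ)).IsHaarMeasure :=
    Measure.isHaarMeasure_haarMeasure ⊤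
  exact (measurePreserving_pi_expChart_specialUnitaryGroup (β := PBond P j) η
    (HaarData.haar : Measure (Matrix.specialUnitaryGroup (Fin N) ℂ))).map_eq

/-- ★★ **S1 ON THE FINE SIDE**: a chart `Ψ'` into 𝔤-VALUED level-`j` bond fields pushing a reference `M` onto `⊗_b coordMeasure` restricted to the pull-back of a
measurable set `S` of group-valued fields is, composed with the bondwise exponential chart, a chart pushing `M` onto `fieldMeasure P j (SU N)` restricted to
`S` — dag-n11-d's `hpush` at the fine carrier of record (FILE 2 §3 at the presentation `fieldMeasure_eq_map_pi_expChart`; `hfib` is literal). -/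
theorem socket_fieldMeasure_of_socket_coordMeasure_fine {Z : Type*} [MeasurableSpace Z] (M : Measure Z) (P : Params) (j : ℕ)
    {Ψ' : Z → (PBond P j → (specialUnitaryLogChart (Fin N)).lie)} (hΨ' : Measurable Ψ')
    {S : Set (GaugeField P j (Matrix.specialUnitaryGroup (Fin N) ℂ))} (hS : MeasurableSet S)
    (hpush' : M.map Ψ' =
      (Measure.pi fun _ : PBond P j =>
          coordMeasure η (HaarData.haar : Measure (Matrix.specialUnitaryGroup (Fin N) ℂ))).restrict
        ((fun A : PBond P j → (specialUnitaryLogChart (Fin N)).lie =>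
            fun b => (isChartRep_specialUnitaryGroup (n := Fin N)).expChart (A b)) ⁻¹' S)) :
    M.map ((fun A : PBond P j → (specialUnitaryLogChart (Fin N)).lie =>
        fun b => (isChartRep_specialUnitaryGroup (n := Fin N)).expChart (A b)) ∘ Ψ')
      = (fieldMeasure P j (Matrix.specialUnitaryGroup (Fin N) ℂ)).restrict S :=
  map_comp_eq_restrict_of_map_eq_restrict_preimage M hΨ'
    (measurable_pi_expChart P j) (fieldMeasure_eq_map_pi_expChart η P j) hS hpush'

/-- ★★ **S1 ON THE COARSE SIDE (the base of `μ ⊗ₘ κ`)**: a socket identity computed with BASE `⊗_c coordMeasure` on 𝔤-valued level-`j'` fields — fibre kernel read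
at the exponentiated field, Jacobian and chart composed with the bondwise exponential chart on the base coordinate — IS the socket identity with base
`fieldMeasure P j' (SU N)` (§1 at the presentation `fieldMeasure_eq_map_pi_expChart`). -/
theorem socket_fieldMeasure_of_socket_coordMeasure_coarse {X β : Type*} [MeasurableSpace X] [MeasurableSpace β] (P : Params) (j' : ℕ)
    (κ : Kernel (GaugeField P j' (Matrix.specialUnitaryGroup (Fin N) ℂ)) X) [IsSFiniteKernel κ]
    {J : GaugeField P j' (Matrix.specialUnitaryGroup (Fin N) ℂ) × X → ℝ≥0∞} (hJ : Measurable J)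
    {Ψ : GaugeField P j' (Matrix.specialUnitaryGroup (Fin N) ℂ) × X → β} (hΨ : Measurable Ψ) {ν : Measure β} {S : Set β}
    (hpush' : (((Measure.pi fun _ : PBond P j' =>
          coordMeasure η (HaarData.haar : Measure (Matrix.specialUnitaryGroup (Fin N) ℂ))) ⊗ₘ
          (κ.comap (fun A : PBond P j' → (specialUnitaryLogChart (Fin N)).lie =>
              fun c => (isChartRep_specialUnitaryGroup (n := Fin N)).expChart (A c))
            (measurable_pi_expChart P j'))).withDensity
          (fun z => J (fun c => (isChartRep_specialUnitaryGroup (n := Fin N)).expChart (z.1 c), z.2))).map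
        (fun z => Ψ (fun c => (isChartRep_specialUnitaryGroup (n := Fin N)).expChart (z.1 c), z.2)) = ν.restrict S) :
    (((fieldMeasure P j' (Matrix.specialUnitaryGroup (Fin N) ℂ)) ⊗ₘ κ).withDensity J).map Ψ = ν.restrict S := by
  haveI : (HaarData.haar : Measure (Matrix.specialUnitaryGroup (Fin N) ℂ)).IsHaarMeasure :=
    Measure.isHaarMeasure_haarMeasure ⊤
  -- the `IsSFiniteKernel` instance is handed over explicitly: the two (definitionally equal) measurable structures on
  -- `GaugeField` (the cell's and `MeasurableSpace.pi`) are not syntactically identified by instance search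
  have hκ : IsSFiniteKernel κ := inferInstance
  exact @socket_of_coarse_presentation _ _ _ _ _ _ _ _
    (Measure.pi fun _ : PBond P j' => coordMeasure η (HaarData.haar : Measure (Matrix.specialUnitaryGroup (Fin N) ℂ))) _ _
    (measurable_pi_expChart P j') _
    (fieldMeasure_eq_map_pi_expChart η P j') κ hκ _ hJ _ hΨ _ _ hpush'

end Record

end Summit.QuantumFields.YangMills.Theorems.BalabanUVNodesN11FibreChartSocketRecoordinatisation
end
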